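import Literature.Analysis.FluidPDE.BoundedMildWeakL3LocalEnergySolution
import Literature.Analysis.FluidPDE.KNSSLiouvillePlanarHolds
import Literature.Analysis.FluidPDE.OseenHeatKernelBridge
import Literature.Analysis.FluidPDE.OseenKernelLp
import Literature.Analysis.FluidPDE.KatoLocalBoundedPicard
import Literature.Analysis.FluidPDE.OseenWindowLpPropagation
import HarnessLib

/-!
# Bounded mild solutions on a window: spatial smoothness and the `L²` remainder

Analysis/FluidPDE support file (theorems only) on the discharge path of
`Literature.Analysis.FluidPDE.AlbrittonBarker2019_liouville_weakL3_backward`, step "initial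
layer for weak-`L³` data" (Barker–Seregin–Šverák, arXiv:1603.03211, Lemma 3.4). For a bounded,
jointly continuous, weakly divergence-free solution `u` of the Oseen integral equation
`u(t) = e^{(t−s)Δ}u(s) − B¹_s(u,u)(t)` on `[0, S] × ℝ³`:

* `smooth_of_oseenForward` — **KNSS 2009, §4 for the window**: `u(t) ∈ C^∞` and `div u(t) = 0`
  for `t ∈ (0, S)`, `∇u` bounded on `(δ, S) × ℝ³` and Lipschitz in time there
  (`KNSS2009_mild_regularity_holds` applied to the time-clamped field, which is drift-mild with
  zero drift by `driftDuhamel_zero_eq_oseenDuhamel`); `continuousOn_fderiv_of_oseenForward` — joint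
  continuity of `∇u` on `(0, S) × ℝ³`;
* `eLpNorm_two_sub_heatExtension_le_of_oseenForward` — **the remainder `u(t) − e^{tΔ}u(0)` is in
  `L²` with `‖u(t) − e^{tΔ}u(0)‖₂ ≤ C t^{1/2} sup_s ‖u(s)‖²_{L⁴}`** when `u(0) ∈ L⁴` (Minkowski's
  integral inequality in time and the `L² → L²` bound `‖N_σ[a,b]‖₂ ≤ C σ^{-1/2} ‖|a||b|‖₂` of
  the Oseen slice, `exists_eLpNorm_oseenSlice_le`).

## References

* H. Koch, N. Nadirashvili, G. Seregin, V. Šverák, *Liouville theorems for the Navier–Stokes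
  equations and applications*, Acta Math. 203 (2009), §4. [`KochNadirashviliSereginSverak2009`]
* T. Barker, G. Seregin, V. Šverák, arXiv:1603.03211, Lemma 3.4. [`BarkerSeregin2016`]
* P. G. Lemarié-Rieusset, *The Navier–Stokes Problem in the 21st Century* (2016), Thm. 7.5.
  [`LemarieRieusset2016`]
-/

noncomputable section

open MeasureTheory Set Function Filter Metric TopologicalSpace InnerProductSpace
open _root_.Topology
open scoped NNReal ENNReal Laplacian RealInnerProductSpace ContDiff

namespace Literature.Analysis.FluidPDE

open UnboundedOperators FunctionSpaces

variable {S : ℝ} {u : ℝ → EuclideanSpace ℝ (Fin 3) → EuclideanSpace ℝ (Fin 3)}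

/-! ### KNSS regularity on the window -/

/-- **The time-clamped field of a bounded Oseen solution is drift-mild with zero drift**
(KNSS 2009, §4 (i)): `V(t) = u(max 0 (min t S))` is jointly continuous (hence measurable),
bounded, weakly divergence free at every time, and satisfies the drift-mild identity on
`0 < s < t < S` (`driftDuhamel_zero_eq_oseenDuhamel`). [cite: KochNadirashviliSereginSverak2009, §4 (i) (arXiv:0709.3599v1 p. 8)] -/
theorem isKNSSDriftMild_clamp_of_oseenForward (hS : 0 < S)
    (hcont : ContinuousOn (uncurry u) (Icc 0 S ×ˢ univ)) {K : ℝ}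
    (hK : ∀ t ∈ Icc 0 S, ∀ x, ‖u t x‖ ≤ K) (hdiv : ∀ t ∈ Icc 0 S, IsWeaklyDivFree (u t))
    (hmild : ∀ s t : ℝ, 0 ≤ s → s < t → t ≤ S → ∀ x,
      u t x = heatExtension (u s) (t - s) x - oseenDuhamel 1 s u u t x) :
    IsKNSSDriftMild S K (fun t x => u (max 0 (min t S)) x) 0 := by
  have hκc : Continuous (fun τ : ℝ => max 0 (min τ S)) := continuous_const.max (continuous_id.min continuous_const)
  have hκmem : ∀ τ : ℝ, max 0 (min τ S) ∈ Icc 0 S := fun τ =>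
    ⟨le_max_left _ _, max_le hS.le (min_le_right _ _)⟩
  have hκid : ∀ τ ∈ Icc 0 S, max 0 (min τ S) = τ := fun τ hτ => by
    rw [min_eq_left hτ.2, max_eq_right hτ.1]
  have hK0 : 0 ≤ K := (norm_nonneg _).trans (hK 0 ⟨le_rfl, hS.le⟩ 0)
  have hcontV : Continuous (uncurry fun t x => u (max 0 (min t S)) x) := by
    have hmap : Continuous fun p : ℝ × EuclideanSpace ℝ (Fin 3) => (max 0 (min p.1 S), p.2) :=
      (hκc.comp continuous_fst).prodMk continuous_snd
    have hinto : ∀ p : ℝ × EuclideanSpace ℝ (Fin 3),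
        (max 0 (min p.1 S), p.2) ∈ Icc 0 S ×ˢ (univ : Set (EuclideanSpace ℝ (Fin 3))) := fun p =>
      ⟨hκmem p.1, mem_univ _⟩
    exact (hcont.comp_continuous hmap hinto).congr fun p => rfl
  refine IsKNSSDriftMild.mk measurable_const (fun t => by simpa using hK0) hcontV.measurable
    (fun t _ x => hK _ (hκmem t) x) ?_ ?_
  · exact Eventually.of_forall fun t => hdiv _ (hκmem t)
  · intro s t hs hst htS x
    have hsid : max 0 (min s S) = s := hκid s ⟨hs.le, (hst.trans htS).le⟩
    have htid : max 0 (min t S) = t := hκid t ⟨(hs.trans hst).le, htS.le⟩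
    have hslice : ∀ σ ∈ Icc 0 S, Continuous (u σ) := fun σ hσ =>
      (hcont.comp_continuous (f := fun x : EuclideanSpace ℝ (Fin 3) => (σ, x)) (by fun_prop)
        fun x => ⟨hσ, mem_univ _⟩).congr fun x => rfl
    have hVm : ∀ σ ∈ Ioo s t, Measurable fun x => u (max 0 (min σ S)) x := fun σ _ =>
      (hslice _ (hκmem σ)).measurable
    have hVN : ∀ σ ∈ Ioo s t, ∀ y, ‖u (max 0 (min σ S)) y‖ ≤ K := fun σ _ y => hK _ (hκmem σ) y
    rw [driftDuhamel_zero_eq_oseenDuhamel finrank_euclideanSpace_fin hVm hVN hst.le x]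
    have hcongr : ∀ τ ∈ Ioo s t, (fun x => u (max 0 (min τ S)) x) = u τ := fun τ hτ => by
      funext y; rw [hκid τ ⟨(hs.trans hτ.1).le, (hτ.2.trans htS).le⟩]
    have hD : oseenDuhamel 1 s (fun τ x => u (max 0 (min τ S)) x) (fun τ x => u (max 0 (min τ S)) x) t x =
        oseenDuhamel 1 s u u t x := by
      rw [oseenDuhamel_apply, oseenDuhamel_apply]
      refine setIntegral_congr_fun measurableSet_Ioo fun τ hτ => ?_
      simp only [hcongr τ hτ]
    rw [hD]
    simp only [hsid, htid]
    exact hmild s t hs.le hst htS.le x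

/-- **Spatial smoothness of bounded Oseen solutions on a window** (KNSS 2009, §4 with (4.10)–(4.11)):
for `t ∈ (0, S)` the slice `u(t)` is `C^∞` and divergence free, `∇u` is bounded on every
`(δ, S) × ℝ³` and Lipschitz in time there. [cite: KochNadirashviliSereginSverak2009, Prop. 4.1 with (4.6) and §4 (4.8)–(4.11) (arXiv:0709.3599v1 p. 8)] -/
theorem smooth_of_oseenForward (hS : 0 < S)
    (hcont : ContinuousOn (uncurry u) (Icc 0 S ×ˢ univ)) {K : ℝ}
    (hK : ∀ t ∈ Icc 0 S, ∀ x, ‖u t x‖ ≤ K) (hdiv : ∀ t ∈ Icc 0 S, IsWeaklyDivFree (u t))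
    (hmild : ∀ s t : ℝ, 0 ≤ s → s < t → t ≤ S → ∀ x,
      u t x = heatExtension (u s) (t - s) x - oseenDuhamel 1 s u u t x) :
    (∀ t ∈ Ioo 0 S, ContDiff ℝ ∞ (u t)) ∧ (∀ t ∈ Ioo 0 S, VectorCalculus.IsDivFree (u t)) ∧
    (∀ δ : ℝ, 0 < δ → ∃ C₁ : ℝ, ∀ t ∈ Ioo δ S, ∀ x, ‖fderiv ℝ (u t) x‖ ≤ C₁) ∧
    (∀ δ : ℝ, 0 < δ → ∃ L₁ : ℝ, ∀ s ∈ Ioo δ S, ∀ t ∈ Ioo δ S, ∀ x,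
      ‖fderiv ℝ (u t) x - fderiv ℝ (u s) x‖ ≤ L₁ * |t - s|) := by
  have hV := isKNSSDriftMild_clamp_of_oseenForward hS hcont hK hdiv hmild
  obtain ⟨C, L, hCL⟩ := KNSS2009_mild_regularity_holds K S hS
  obtain ⟨hsm, hdf, hCk, hLk, -⟩ := hCL hV
  have hκid : ∀ τ ∈ Icc 0 S, max 0 (min τ S) = τ := fun τ hτ => by
    rw [min_eq_left hτ.2, max_eq_right hτ.1]
  have hfun : ∀ t ∈ Ioo 0 S, (fun x => u (max 0 (min t S)) x) = u t := fun t ht => by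
    funext x; rw [hκid t ⟨ht.1.le, ht.2.le⟩]
  refine ⟨fun t ht => ?_, fun t ht => ?_, fun δ hδ => ⟨C 1 δ, fun t ht x => ?_⟩,
    fun δ hδ => ⟨L 1 δ, fun s hs t ht x => ?_⟩⟩
  · have h := hsm t ht; rwa [hfun t ht] at h
  · have h := hdf t ht; rwa [hfun t ht] at h
  · have ht0 : t ∈ Ioo 0 S := ⟨hδ.trans ht.1, ht.2⟩
    have h := hCk δ hδ 1 t ht x
    rw [hfun t ht0, norm_iteratedFDeriv_one] at h
    exact h
  · have hs0 : s ∈ Ioo 0 S := ⟨hδ.trans hs.1, hs.2⟩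
    have ht0 : t ∈ Ioo 0 S := ⟨hδ.trans ht.1, ht.2⟩
    have h := hLk δ hδ 1 s hs t ht x
    rw [hfun t ht0, hfun s hs0] at h
    have hst : ContDiff ℝ 1 (u t) := by
      have := hsm t ht0; rw [hfun t ht0] at this; exact this.of_le (by exact_mod_cast le_top)
    have hss : ContDiff ℝ 1 (u s) := by
      have := hsm s hs0; rw [hfun s hs0] at this; exact this.of_le (by exact_mod_cast le_top)
    have e : iteratedFDeriv ℝ 1 (u t) x - iteratedFDeriv ℝ 1 (u s) x = iteratedFDeriv ℝ 1 (u t - u s) x := by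
      rw [iteratedFDeriv_sub_apply hst.contDiffAt hss.contDiffAt]
    rw [e, norm_iteratedFDeriv_one, fderiv_sub ((hst.differentiable one_ne_zero) x) ((hss.differentiable one_ne_zero) x)] at h
    exact h

/-- **Joint continuity of `∇u` on `(0, S) × ℝ³`** (continuity in `x` of the smooth slices and the
time-Lipschitz bound of KNSS (4.11)). [folklore] -/
theorem continuousOn_fderiv_of_oseenForward (hS : 0 < S)
    (hcont : ContinuousOn (uncurry u) (Icc 0 S ×ˢ univ)) {K : ℝ}
    (hK : ∀ t ∈ Icc 0 S, ∀ x, ‖u t x‖ ≤ K) (hdiv : ∀ t ∈ Icc 0 S, IsWeaklyDivFree (u t))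
    (hmild : ∀ s t : ℝ, 0 ≤ s → s < t → t ≤ S → ∀ x,
      u t x = heatExtension (u s) (t - s) x - oseenDuhamel 1 s u u t x) :
    ContinuousOn (fun q : ℝ × EuclideanSpace ℝ (Fin 3) => fderiv ℝ (u q.1) q.2) (Ioo 0 S ×ˢ univ) := by
  obtain ⟨hsm, -, -, hLip⟩ := smooth_of_oseenForward hS hcont hK hdiv hmild
  refine continuousOn_of_forall_continuousAt fun q hq => ?_
  obtain ⟨hq1, -⟩ := mem_prod.1 hq
  have hδ : 0 < q.1 / 2 := by linarith [hq1.1]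
  obtain ⟨L₁, hL₁⟩ := hLip (q.1 / 2) hδ
  have hq1' : q.1 ∈ Ioo (q.1 / 2) S := ⟨by linarith [hq1.1], hq1.2⟩
  -- `F r - F q = (F r - ∇u(q.1)(r.2)) + (∇u(q.1)(r.2) - F q)`, both small near `q`
  have hx : Tendsto (fun r : ℝ × EuclideanSpace ℝ (Fin 3) => fderiv ℝ (u q.1) r.2) (𝓝 q) (𝓝 (fderiv ℝ (u q.1) q.2)) :=
    (((hsm q.1 hq1).continuous_fderiv (by simp)).continuousAt).tendsto.comp (continuous_snd.tendsto q)
  have hx0 : Tendsto (fun r : ℝ × EuclideanSpace ℝ (Fin 3) => ‖fderiv ℝ (u q.1) r.2 - fderiv ℝ (u q.1) q.2‖) (𝓝 q) (𝓝 0) :=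
    tendsto_iff_norm_sub_tendsto_zero.1 hx
  have ht0 : Tendsto (fun r : ℝ × EuclideanSpace ℝ (Fin 3) => L₁ * |r.1 - q.1|) (𝓝 q) (𝓝 0) := by
    have h1 : Tendsto (fun r : ℝ × EuclideanSpace ℝ (Fin 3) => r.1 - q.1) (𝓝 q) (𝓝 0) := by
      have := (continuous_fst.tendsto q).sub_const q.1
      simpa using this
    simpa using (continuous_abs.tendsto 0 |>.comp h1).const_mul L₁
  have hU : Ioo (q.1 / 2) S ×ˢ (univ : Set (EuclideanSpace ℝ (Fin 3))) ∈ 𝓝 q :=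
    (isOpen_Ioo.prod isOpen_univ).mem_nhds (mk_mem_prod hq1' (mem_univ _))
  have hbound : ∀ᶠ r in 𝓝 q, ‖fderiv ℝ (u r.1) r.2 - fderiv ℝ (u q.1) q.2‖ ≤
      L₁ * |r.1 - q.1| + ‖fderiv ℝ (u q.1) r.2 - fderiv ℝ (u q.1) q.2‖ := by
    filter_upwards [hU] with r hr
    obtain ⟨hr1, -⟩ := mem_prod.1 hr
    calc ‖fderiv ℝ (u r.1) r.2 - fderiv ℝ (u q.1) q.2‖
        = ‖(fderiv ℝ (u r.1) r.2 - fderiv ℝ (u q.1) r.2) + (fderiv ℝ (u q.1) r.2 - fderiv ℝ (u q.1) q.2)‖ := by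
          congr 1; abel
      _ ≤ ‖fderiv ℝ (u r.1) r.2 - fderiv ℝ (u q.1) r.2‖ + ‖fderiv ℝ (u q.1) r.2 - fderiv ℝ (u q.1) q.2‖ :=
          norm_add_le _ _
      _ ≤ L₁ * |r.1 - q.1| + ‖fderiv ℝ (u q.1) r.2 - fderiv ℝ (u q.1) q.2‖ := by
          have h := hL₁ q.1 hq1' r.1 hr1 r.2
          linarith
  refine tendsto_iff_norm_sub_tendsto_zero.2 (squeeze_zero_norm' ?_ (by simpa using ht0.add hx0))
  filter_upwards [hbound] with r hr
  rw [Real.norm_of_nonneg (norm_nonneg _)]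
  exact hr

/-! ### The `L²` remainder `u(t) - e^{tΔ}u(0)` -/

/-- **`L²` bound of the Duhamel term from `L⁴` slices**: there is an absolute `C` such that for a
bounded jointly continuous `u` on `[0, S] × ℝ³` with `‖u(τ)‖_{L⁴} ≤ L` on `(0, S)`,
`‖B¹₀(u,u)(t)‖_{L²} ≤ C (2√t) L²` for `0 < t ≤ S` (Minkowski's integral inequality in time, the
diagonal bound `‖N_σ[a,b]‖₂ ≤ C σ^{-1/2}‖|a||b|‖₂` of the Oseen slice and Hölder
`‖|a||b|‖₂ ≤ ‖a‖₄‖b‖₄`; Lemarié-Rieusset 2016, Prop. 7.3). [cite: LemarieRieusset2016, Prop. 7.3 (7.32)–(7.33) (PDF p. 152)] -/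
theorem exists_eLpNorm_two_oseenDuhamel_le_of_four :
    ∃ C : ℝ, 0 ≤ C ∧ ∀ {S : ℝ} {u : ℝ → EuclideanSpace ℝ (Fin 3) → EuclideanSpace ℝ (Fin 3)},
      ContinuousOn (uncurry u) (Icc 0 S ×ˢ univ) →
      ∀ {L : ℝ≥0∞}, (∀ τ ∈ Ioo 0 S, eLpNorm (u τ) 4 volume ≤ L) →
      ∀ {t : ℝ}, 0 < t → t ≤ S →
        eLpNorm (oseenDuhamel 1 0 u u t) 2 volume ≤ ENNReal.ofReal (C * (2 * Real.sqrt t)) * L ^ 2 := by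
  haveI := holderTriple_four_four_two
  obtain ⟨C₀, hC₀, hK⟩ := exists_norm_oseenKernel_le (E := EuclideanSpace ℝ (Fin 3))
  set I : ℝ := ∫ w : EuclideanSpace ℝ (Fin 3),
    (1 + ‖w‖ ^ 2) ^ (-(((Module.finrank ℝ (EuclideanSpace ℝ (Fin 3)) : ℝ) + 1) / 2)) with hI
  have hI0 : 0 ≤ I := integral_nonneg fun w => by positivity
  refine ⟨C₀ * I, by positivity, fun {S u} hcont {L} hL {t} ht htS => ?_⟩
  set μτ : Measure ℝ := volume.restrict (Ioo 0 t) with hμτ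
  haveI : SFinite μτ := by rw [hμτ]; infer_instance
  -- joint measurability on the time slab
  have hmeas : AEStronglyMeasurable (uncurry u)
      ((volume : Measure (ℝ × EuclideanSpace ℝ (Fin 3))).restrict (Ioo 0 t ×ˢ univ)) :=
    (hcont.mono (prod_mono (fun τ hτ => ⟨hτ.1.le, hτ.2.le.trans htS⟩) Subset.rfl)).aestronglyMeasurable
      (measurableSet_Ioo.prod MeasurableSet.univ)
  set F : EuclideanSpace ℝ (Fin 3) → ℝ → EuclideanSpace ℝ (Fin 3) := fun x τ =>
    ∫ y, oseenKernel (1 * (t - τ)) (x - y) (u τ y) (u τ y) with hF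
  have hB : oseenDuhamel 1 0 u u t = fun x => ∫ τ, F x τ ∂μτ := rfl
  have hMink := FunctionSpaces.eLpNorm_integral_le_lintegral_eLpNorm
    (μ := (volume : Measure (EuclideanSpace ℝ (Fin 3)))) (ν := μτ)
    (aestronglyMeasurable_uncurry_oseenSlice 1 t hmeas hmeas) one_le_two (by norm_num)
  have hslice : ∀ᵐ τ ∂μτ, eLpNorm (fun x => F x τ) 2 volume ≤
      ENNReal.ofReal (C₀ * I) * ENNReal.ofReal ((t - τ) ^ (-(1 / 2 : ℝ))) * L ^ 2 := by
    filter_upwards [ae_aestronglyMeasurable_slice hmeas, ae_restrict_mem measurableSet_Ioo] with τ huτ hτ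
    have hσ : 0 < 1 * (t - τ) := by rw [one_mul]; exact sub_pos.2 hτ.2
    have hτS : τ ∈ Ioo 0 S := ⟨hτ.1, hτ.2.trans_le htS⟩
    have h1 := eLpNorm_oseenSlice_le_same hC₀.le hK hσ huτ huτ one_le_two
    have h2 : eLpNorm (fun y => ‖u τ y‖ * ‖u τ y‖) 2 volume ≤ L ^ 2 := by
      refine (eLpNorm_norm_mul_norm_le huτ huτ 4 4 2).trans ?_
      rw [sq]
      exact mul_le_mul' (hL τ hτS) (hL τ hτS)
    calc eLpNorm (fun x => F x τ) 2 volume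
        ≤ ENNReal.ofReal (C₀ * ((1 * (t - τ)) ^ (-(1 / 2 : ℝ)) * I)) *
            eLpNorm (fun y => ‖u τ y‖ * ‖u τ y‖) 2 volume := h1
      _ ≤ ENNReal.ofReal (C₀ * ((1 * (t - τ)) ^ (-(1 / 2 : ℝ)) * I)) * L ^ 2 := by gcongr
      _ = ENNReal.ofReal (C₀ * I) * ENNReal.ofReal ((t - τ) ^ (-(1 / 2 : ℝ))) * L ^ 2 := by
          rw [one_mul, ← ENNReal.ofReal_mul (by positivity)]
          congr 2
          ring
  calc eLpNorm (oseenDuhamel 1 0 u u t) 2 volume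
      = eLpNorm (fun x => ∫ τ, F x τ ∂μτ) 2 volume := by rw [hB]
    _ ≤ ∫⁻ τ, eLpNorm (fun x => F x τ) 2 volume ∂μτ := hMink
    _ ≤ ∫⁻ τ, ENNReal.ofReal (C₀ * I) * ENNReal.ofReal ((t - τ) ^ (-(1 / 2 : ℝ))) * L ^ 2 ∂μτ :=
        lintegral_mono_ae hslice
    _ = ENNReal.ofReal (C₀ * I) * (∫⁻ τ, ENNReal.ofReal ((t - τ) ^ (-(1 / 2 : ℝ))) ∂μτ) * L ^ 2 := by
        have hm : Measurable fun τ : ℝ => ENNReal.ofReal ((t - τ) ^ (-(1 / 2 : ℝ))) :=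
          ((measurable_const.sub measurable_id).pow_const _).ennreal_ofReal
        rw [lintegral_mul_const _ (hm.const_mul _), lintegral_const_mul _ hm]
    _ = ENNReal.ofReal (C₀ * I * (2 * Real.sqrt t)) * L ^ 2 := by
        rw [hμτ, setLIntegral_Ioo_sub_rpow_neg_half_of_lt ht, ← ENNReal.ofReal_mul (by positivity), sub_zero]

/-- **The remainder `u(t) − e^{tΔ}u(0)` of a bounded Oseen solution with `u(0) ∈ L⁴` is in `L²`,
with `‖u(t) − e^{tΔ}u(0)‖₂ ≤ C₁ √t`** for `t ∈ (0, S]`, `C₁` depending on `u` only through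
`sup_{[0,S]} ‖u(t)‖_{L⁴} < ∞` (`oseenWindow_exists_forall_memLp_eLpNorm_le`); in particular
`‖u(t) − e^{tΔ}u(0)‖₂ → 0` as `t → 0`. [cite: BarkerSeregin2016, Lemma 3.4 (proof)] -/
theorem eLpNorm_two_sub_heatExtension_le_of_oseenForward (hS : 0 < S)
    (hcont : ContinuousOn (uncurry u) (Icc 0 S ×ˢ univ)) {K : ℝ}
    (hK : ∀ t ∈ Icc 0 S, ∀ x, ‖u t x‖ ≤ K)
    (hmild : ∀ s t : ℝ, 0 ≤ s → s < t → t ≤ S → ∀ x,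
      u t x = heatExtension (u s) (t - s) x - oseenDuhamel 1 s u u t x)
    (h4 : MemLp (u 0) 4 volume) :
    ∃ C₁ : ℝ, 0 ≤ C₁ ∧ ∀ t ∈ Ioc 0 S,
      MemLp (fun x => u t x - heatExtension (u 0) t x) 2 volume ∧
      eLpNorm (fun x => u t x - heatExtension (u 0) t x) 2 volume ≤ ENNReal.ofReal (C₁ * Real.sqrt t) := by
  obtain ⟨C, hC0, hC⟩ := exists_eLpNorm_two_oseenDuhamel_le_of_four
  obtain ⟨B, hB, hB4⟩ := oseenWindow_exists_forall_memLp_eLpNorm_le (p := 4) (by norm_num) (by norm_num)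
    hS hcont hK hmild h4
  have hL : ∀ τ ∈ Ioo 0 S, eLpNorm (u τ) 4 volume ≤ B := fun τ hτ => (hB4 τ ⟨hτ.1.le, hτ.2.le⟩).2
  refine ⟨C * 2 * B.toReal ^ 2, by positivity, fun t ht => ?_⟩
  have hrepr : (fun x => u t x - heatExtension (u 0) t x) = fun x => -oseenDuhamel 1 0 u u t x := by
    funext x
    have h := hmild 0 t le_rfl ht.1 ht.2 x
    rw [sub_zero] at h
    rw [h]; abel
  have hslice : ∀ τ ∈ Icc 0 S, Continuous (u τ) := fun τ hτ =>
    (hcont.comp_continuous (f := fun x : EuclideanSpace ℝ (Fin 3) => (τ, x)) (by fun_prop)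
      fun x => ⟨hτ, mem_univ _⟩).congr fun x => rfl
  have hcU : Continuous (fun x => u t x - heatExtension (u 0) t x) :=
    (hslice t ⟨ht.1.le, ht.2⟩).sub (contDiff_heatExtension_holds h4 (by norm_num) ht.1).continuous
  have hBeq : B = ENNReal.ofReal B.toReal := (ENNReal.ofReal_toReal hB.ne).symm
  have hbound : eLpNorm (fun x => u t x - heatExtension (u 0) t x) 2 volume ≤
      ENNReal.ofReal (C * 2 * B.toReal ^ 2 * Real.sqrt t) := by
    rw [hrepr]
    change eLpNorm (-(oseenDuhamel 1 0 u u t)) 2 volume ≤ _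
    rw [eLpNorm_neg]
    refine (hC hcont hL ht.1 ht.2).trans_eq ?_
    rw [hBeq, ← ENNReal.ofReal_pow ENNReal.toReal_nonneg, ← ENNReal.ofReal_mul (by positivity),
      ENNReal.toReal_ofReal ENNReal.toReal_nonneg]
    congr 1
    ring
  exact ⟨⟨hcU.aestronglyMeasurable, hbound.trans_lt ENNReal.ofReal_lt_top⟩, hbound⟩

end Literature.Analysis.FluidPDE

end
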